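import Mathlib.NumberTheory.Chebyshev
import Literature.NumberTheory.LFunctions.ThetaChainCheck
import Literature.NumberTheory.LFunctions.ChainTableFacts
import HarnessLib

/-!
# Schoenfeld's `θ`-bound on a finite range by kernel computation: soundness of the checker
# (plan N2 of provefact `Literature.NumberTheory.LFunctions.robin_iff`)

Topic: `Literature/NumberTheory/LFunctions`. The semantic soundness of the `θ`-chain checker
`ThetaChainCheck.lean` over the complete prime table `ChainTable.table` (`ChainTableFacts.tableOK`):
if a chunk of the run succeeds, `runD fuel s = some s'`, the **invariant** `Inv s` is transported
to `s'` (`runD_sound`); the initial state satisfies it (`initS_inv`); and a final state at a prime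
`P > 599` yields Schoenfeld's inequality `|θ(x) − x| ≤ √x log² x/(8π)` for all real `599 ≤ x ≤ P`
(`abs_theta_sub_le_of_inv`). The kernel facts (the chunks of the run) and the assembly are
`ThetaChainRun*.lean` and `ThetaSmallRange.lean`.

## The argument

* `Inv s` (for a state at the prime `p = s.p`): `p` is a table entry and prime; the enclosures
  `Llo ≤ 2⁸⁰ log p ≤ Lhi`, `Tlo ≤ 2⁸⁰ θ(p) ≤ Thi`; the one-sided bounds at `p` itself,
  `θ(p) − p ≤ B(p)` (if `p ≥ 599`) and `p − θ(p) ≤ B(p)` (if `p > 599`); and the target inequality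
  `|θ(x) − x| ≤ B(x)` for all real `599 ≤ x < p`, where `B(x) = √x log² x/(8π)` (`bnd`).
* One step `p → p'` (`step_inv`): `p'` is the table successor of `p` (`ChainCheck.head_after`), odd,
  and prime by `primeChk_sound` (`p' ≤ 4599989 < 2153²`); by completeness of the table there is no
  prime strictly between `p` and `p'`, so `θ` is constant `= θ(p)` on `[p, p')` and
  `θ(p') = θ(p) + log p'` (`theta_eq_of_noPrime`, `theta_succ_prime`); `logNext_sound` and these give
  the new enclosures. If `p ≥ 599`, the right-end check gives `p' − θ(p) ≤ B(p)` (`chkB_sound`), and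
  with `θ(p) − p ≤ B(p)` and the monotonicity of `B` on `[1, ∞)` (`bnd_mono`) the inequality on
  `[p, p')` (`abs_theta_sub_le_Ico`); if `p < 599 ≤ x < p'` cannot occur (`599` is prime, so
  `p' ≤ 599`). The check at `p'` gives `θ(p') − p' ≤ B(p')`, and `p' − θ(p') ≤ p' − θ(p) ≤ B(p) ≤ B(p')`.
* `run_sound`/`runD_sound` iterate along `ChainCheck.after p table` (`ChainCheck.tail_after`);
  `initS_inv`: `θ(2) = log 2`; `abs_theta_sub_le_of_inv`: at the final prime `P > 599` both one-sided
  bounds hold, and below `P` the invariant applies.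

## References

* L. Schoenfeld, *Sharper bounds for the Chebyshev functions θ(x) and ψ(x). II*, Math. Comp. 30
  (1976), 337–360, Thm. 10 (6.3) (the inequality certified) and p. 339 (its range below `e¹⁶`,
  there settled by tables). [Schoenfeld1976]
-/

noncomputable section

namespace Literature.NumberTheory.LFunctions.ThetaChain

open ChainCheck ChainTable Real Finset
open scoped Chebyshev

/-! ### Schoenfeld's bound `B(x) = √x log² x/(8π)` -/

/-- Schoenfeld's bound `B(x) = √x · log² x/(8π)` (the right-hand side of (6.3)).
[cite: Schoenfeld1976, Thm. 10 (6.3)] -/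
def bnd (x : ℝ) : ℝ := Real.sqrt x * Real.log x ^ 2 / (8 * Real.pi)

/-- `B` is non-decreasing on `[1, ∞)`. [folklore] -/
theorem bnd_mono {x y : ℝ} (hx : 1 ≤ x) (hxy : x ≤ y) : bnd x ≤ bnd y := by
  unfold bnd
  have hπ := Real.pi_pos
  have hlx : 0 ≤ Real.log x := Real.log_nonneg hx
  have hlxy : Real.log x ≤ Real.log y := Real.log_le_log (by linarith) hxy
  apply div_le_div_of_nonneg_right _ (by positivity)
  exact mul_le_mul (Real.sqrt_le_sqrt hxy) (pow_le_pow_left₀ hlx hlxy 2) (by positivity)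
    (Real.sqrt_nonneg _)

/-! ### `θ` along the integers -/

/-- `θ(n+1) = θ(n) + log(n+1)` if `n+1` is prime, `= θ(n)` otherwise. [folklore] -/
theorem theta_natSucc (n : ℕ) :
    θ ((n + 1 : ℕ) : ℝ) = θ (n : ℝ) + if (n + 1).Prime then Real.log ((n + 1 : ℕ) : ℝ) else 0 := by
  simp only [Chebyshev.theta, Nat.floor_natCast, Finset.sum_filter]
  rw [Finset.sum_Ioc_succ_top (Nat.zero_le n)]

/-- If there is no prime in `(p, n]` then `θ(n) = θ(p)`. [folklore] -/
theorem theta_eq_of_noPrime {p : ℕ} : ∀ {n : ℕ}, p ≤ n → (∀ q : ℕ, p < q → q ≤ n → ¬ q.Prime) →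
    θ (n : ℝ) = θ (p : ℝ)
  | 0, h, _ => by
      have : p = 0 := by omega
      subst this; rfl
  | n + 1, h, hq => by
      rcases Nat.eq_or_lt_of_le h with rfl | hlt
      · rfl
      · rw [theta_natSucc, if_neg (hq (n + 1) (by omega) le_rfl), add_zero]
        exact theta_eq_of_noPrime (by omega) fun q h1 h2 => hq q h1 (by omega)

/-- If `p'` is prime and there is no prime in `(p, p')` then `θ(p') = θ(p) + log p'`. [folklore] -/
theorem theta_succ_prime {p p' : ℕ} (hp' : p'.Prime) (hlt : p < p')
    (hq : ∀ q : ℕ, p < q → q < p' → ¬ q.Prime) :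
    θ (p' : ℝ) = θ (p : ℝ) + Real.log p' := by
  obtain ⟨m, rfl⟩ : ∃ m, p' = m + 1 := ⟨p' - 1, by have := hp'.one_lt; omega⟩
  rw [theta_natSucc, if_pos hp', theta_eq_of_noPrime (by omega) fun q h1 h2 => hq q h1 (by omega)]

/-- `θ` is constant on `[p, p')` when there is no prime in `(p, p')`: for real `p ≤ x < p'`,
`θ(x) = θ(p)`. [folklore] -/
theorem theta_real_eq {p p' : ℕ} (hq : ∀ q : ℕ, p < q → q < p' → ¬ q.Prime) {x : ℝ}
    (hpx : (p : ℝ) ≤ x) (hxp : x < p') : θ x = θ (p : ℝ) := by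
  have hx0 : 0 ≤ x := le_trans (Nat.cast_nonneg p) hpx
  rw [Chebyshev.theta_eq_theta_coe_floor x]
  have h1 : p ≤ ⌊x⌋₊ := Nat.le_floor hpx
  have h2 : ⌊x⌋₊ < p' := (Nat.floor_lt hx0).2 hxp
  exact theta_eq_of_noPrime h1 fun q hq1 hq2 => hq q hq1 (by omega)

/-! ### The inequality on one interval `[p, p')` -/

/-- From `θ ≡ θ(p)` on `[p, p')`, `θ(p) − p ≤ B(p)`, `p' − θ(p) ≤ B(p)` and `p ≥ 1`:
`|θ(x) − x| ≤ B(x)` for `p ≤ x < p'`. [cite: Schoenfeld1976, Thm. 10 (6.3)] -/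
theorem abs_theta_sub_le_Ico {p p' : ℕ} (hp1 : 1 ≤ p)
    (hq : ∀ q : ℕ, p < q → q < p' → ¬ q.Prime)
    (hleft : θ (p : ℝ) - p ≤ bnd p) (hright : (p' : ℝ) - θ (p : ℝ) ≤ bnd p) {x : ℝ}
    (hpx : (p : ℝ) ≤ x) (hxp : x < p') : |θ x - x| ≤ bnd x := by
  have hp1R : (1 : ℝ) ≤ p := by exact_mod_cast hp1
  have hB : bnd p ≤ bnd x := bnd_mono hp1R hpx
  rw [theta_real_eq hq hpx hxp, abs_sub_le_iff]
  constructor <;> linarith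

/-! ### The invariant -/

/-- **The invariant** of a state of the `θ`-chain (relative to the table `ChainTable.table`).
[folklore] -/
structure Inv (s : TS) : Prop where
  /-- the prime reached is a table entry -/
  mem : s.p ∈ table
  /-- and is prime -/
  prime : s.p.Prime
  /-- `Llo ≤ 2⁸⁰ log p` -/
  Llo_le : (s.Llo : ℝ) ≤ 2 ^ 80 * Real.log s.p
  /-- `2⁸⁰ log p ≤ Lhi` -/
  le_Lhi : 2 ^ 80 * Real.log s.p ≤ s.Lhi
  /-- `Tlo ≤ 2⁸⁰ θ(p)` -/
  Tlo_le : (s.Tlo : ℝ) ≤ 2 ^ 80 * θ (s.p : ℝ)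
  /-- `2⁸⁰ θ(p) ≤ Thi` -/
  le_Thi : 2 ^ 80 * θ (s.p : ℝ) ≤ s.Thi
  /-- the bound above at `p`: `θ(p) − p ≤ B(p)` once `p ≥ 599` -/
  left : 599 ≤ s.p → θ (s.p : ℝ) - s.p ≤ bnd s.p
  /-- the bound below at `p`: `p − θ(p) ≤ B(p)` once `p > 599` -/
  right : 599 < s.p → (s.p : ℝ) - θ (s.p : ℝ) ≤ bnd s.p
  /-- Schoenfeld's inequality below `p` -/
  sch : ∀ x : ℝ, 599 ≤ x → x < s.p → |θ x - x| ≤ bnd x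

/-! ### One step -/

/-- `599` is prime. [folklore] -/
theorem prime_599 : Nat.Prime 599 := by norm_num

/-- Truncated subtraction dominates real subtraction. [folklore] -/
theorem real_sub_le_natSub (a b : ℕ) : (a : ℝ) - b ≤ ((a - b : ℕ) : ℝ) := by
  rcases le_total b a with h | h
  · rw [Nat.cast_sub h]
  · rw [Nat.sub_eq_zero_of_le h]
    push_cast
    have : (a : ℝ) ≤ b := by exact_mod_cast h
    linarith

/-- A guard `bif !c then none else X` that returns `some` passed its test. [folklore] -/
theorem bif_not_none {α : Type} {c : Bool} {X : Option α} {a : α}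
    (h : (bif !c then none else X) = some a) : c = true ∧ X = some a := by
  cases c <;> simp_all

/-- **Soundness of one step.** If `Inv s` holds, `p'` is the table successor of `s.p`, and
`step s p' = some s'`, then `Inv s'` and `s'.p = p'`. [cite: Schoenfeld1976, Thm. 10 (6.3)] -/
theorem step_inv {s s' : TS} (hI : Inv s) {p' : ℕ} {rest : List ℕ}
    (hafter : after s.p table = p' :: rest) (h : step s p' = some s') : Inv s' ∧ s'.p = p' := by
  have hT := tableOK
  obtain ⟨p, Llo, Lhi, Tlo, Thi⟩ := s
  simp only at hafter hI
  obtain ⟨hmem, hprime, hLlo, hLhi, hTlo, hThi, hleft, hright, hsch⟩ := hI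
  simp only at hmem hprime hLlo hLhi hTlo hThi hleft hright hsch
  -- the successor `p'`
  obtain ⟨hp'T, hpp', hmin⟩ := head_after hT.sorted hafter
  have hp'le : p' ≤ 4599989 := hT.bounded p' hp'T
  have hnoprime : ∀ q : ℕ, p < q → q < p' → ¬ q.Prime := fun q h1 h2 hq =>
    absurd (hmin q (hT.complete q hq (by omega)) h1) (not_le.2 h2)
  have hp1 : 1 ≤ p := hprime.one_lt.le
  have hp0 : 0 < p := hprime.pos
  -- unfold the step
  simp only [step, Nat.mul_eq, Nat.sub_eq, Nat.add_eq] at h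
  obtain ⟨hg1, h⟩ := bif_not_none h
  simp only [Bool.and_eq_true] at hg1
  obtain ⟨⟨-, hodd⟩, hchk⟩ := hg1
  have hodd' : Odd p' := Nat.odd_iff.2 (Nat.eq_of_beq_eq_true hodd)
  have hp'prime : p'.Prime := primeChk_sound hchk hodd' (by omega)
  obtain ⟨hg2, h⟩ := bif_not_none h
  rcases hln : logNext p Llo Lhi p' with _ | ⟨Llo', Lhi'⟩
  · rw [hln] at h; simp at h
  · rw [hln] at h
    simp only at h
    obtain ⟨hg3, h⟩ := bif_not_none h
    simp only [Option.some.injEq] at h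
    subst h
    -- the new enclosures
    obtain ⟨hLlo', hLhi'⟩ := logNext_sound hln hp0 hpp'.le hLlo hLhi
    have hθ' : θ (p' : ℝ) = θ (p : ℝ) + Real.log p' := theta_succ_prime hp'prime hpp' hnoprime
    have hθmono : θ (p : ℝ) ≤ θ (p' : ℝ) := Chebyshev.theta_mono (by exact_mod_cast hpp'.le)
    have hp1' : (1 : ℝ) ≤ p := by exact_mod_cast hp1
    have hpp'R : (p : ℝ) ≤ p' := by exact_mod_cast hpp'.le
    -- the right-end check (when `p ≥ 599`)
    have hrightEnd : 599 ≤ p → (p' : ℝ) - θ (p : ℝ) ≤ bnd p := by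
      intro h599
      simp only [Bool.or_eq_true, Nat.blt_eq] at hg2
      rcases hg2 with hlt | hc
      · omega
      · have hD := chkB_sound hc hp1 hLlo
        have h1 : (SC : ℝ) * p' - Tlo ≤ ((SC * p' - Tlo : ℕ) : ℝ) := by
          have := real_sub_le_natSub (SC * p') Tlo
          push_cast at this ⊢
          exact this
        rw [SC_real] at h1
        have h2 : 2 ^ 80 * ((p' : ℝ) - θ (p : ℝ)) ≤ 2 ^ 80 * bnd p := by
          unfold bnd; nlinarith
        exact le_of_mul_le_mul_left h2 (by positivity)
    -- the check at `p'` (when `p' ≥ 599`)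
    have hleftNew : 599 ≤ p' → θ (p' : ℝ) - p' ≤ bnd p' := by
      intro h599
      simp only [Bool.or_eq_true, Nat.blt_eq] at hg3
      rcases hg3 with hlt | hc
      · omega
      · have hD := chkB_sound hc (hp1.trans hpp'.le) hLlo'
        have h1 : ((Thi : ℝ) + Lhi') - SC * p' ≤ ((Thi + Lhi' - SC * p' : ℕ) : ℝ) := by
          have := real_sub_le_natSub (Thi + Lhi') (SC * p')
          push_cast at this ⊢
          exact this
        rw [SC_real] at h1
        have h2 : 2 ^ 80 * (θ (p' : ℝ) - p') ≤ 2 ^ 80 * bnd p' := by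
          unfold bnd; rw [hθ']; nlinarith
        exact le_of_mul_le_mul_left h2 (by positivity)
    -- if `p < 599` then `p' ≤ 599`
    have h599 : p < 599 → p' ≤ 599 := fun hlt =>
      hmin 599 (hT.complete 599 prime_599 (by norm_num)) hlt
    refine ⟨⟨hp'T, hp'prime, hLlo', hLhi', ?_, ?_, hleftNew, ?_, ?_⟩, rfl⟩
    · simp only; rw [hθ']; push_cast; linarith
    · simp only; rw [hθ']; push_cast; linarith
    · -- right at `p'`
      intro h599'
      simp only at h599' ⊢
      have hp599 : 599 ≤ p := by
        by_contra hh
        push Not at hh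
        have := h599 hh
        omega
      have h1 := hrightEnd hp599
      have h2 : bnd p ≤ bnd p' := bnd_mono hp1' hpp'R
      linarith
    · -- Schoenfeld below `p'`
      intro x hx hxp'
      simp only at hxp'
      by_cases hxp : x < p
      · exact hsch x hx hxp
      · push Not at hxp
        have hp599 : 599 ≤ p := by
          by_contra hh
          push Not at hh
          have := h599 hh
          have : (p' : ℝ) ≤ 599 := by exact_mod_cast this
          linarith
        exact abs_theta_sub_le_Ico hp1 hnoprime (hleft hp599) (hrightEnd hp599) hxp hxp'

/-! ### The run -/

/-- **Soundness of a run** along the table cursor. [folklore] -/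
theorem run_sound : ∀ (fuel : ℕ) {s s' : TS}, Inv s → run fuel s (after s.p table) = some s' →
    Inv s'
  | 0, s, s', hI, h => by
      simp only [run, Option.some.injEq] at h
      exact h ▸ hI
  | fuel + 1, s, s', hI, h => by
      rcases hseg : after s.p table with _ | ⟨p', rest⟩
      · rw [hseg] at h
        simp only [run, Option.some.injEq] at h
        exact h ▸ hI
      · rw [hseg] at h
        simp only [run] at h
        rcases hst : step s p' with _ | s₁
        · rw [hst] at h; simp at h
        · rw [hst] at h
          simp only at h
          obtain ⟨hI₁, hp₁⟩ := step_inv hI hseg hst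
          have hrest : rest = after s₁.p table := by
            rw [hp₁]; exact tail_after tableOK.sorted hseg
          rw [hrest] at h
          exact run_sound fuel hI₁ h

/-- **Soundness of a chunk**: `runD` preserves the invariant. [folklore] -/
theorem runD_sound {fuel : ℕ} {s s' : TS} (hI : Inv s) (h : runD fuel s = some s') : Inv s' :=
  run_sound fuel hI h

/-! ### The initial state and the conclusion -/

/-- `θ(2) = log 2`. [folklore] -/
theorem theta_two : θ (2 : ℝ) = Real.log 2 := by
  have h : θ ((2 : ℕ) : ℝ) = ∑ p ∈ Nat.primesLE 2, Real.log p :=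
    Chebyshev.theta_eq_sum_primesLE_log 2
  have hset : Nat.primesLE 2 = {2} := by decide
  rw [hset, Finset.sum_singleton] at h
  exact_mod_cast h

/-- **The initial state satisfies the invariant.** [folklore] -/
theorem initS_inv : Inv initS := by
  refine ⟨tableOK.two_mem, Nat.prime_two, ?_, ?_, ?_, ?_, ?_, ?_, ?_⟩
  · simpa [initS] using L2LON_le
  · simpa [initS] using le_L2HIN
  · simp only [initS]; push_cast; rw [theta_two]; exact L2LON_le
  · simp only [initS]; push_cast; rw [theta_two]; exact le_L2HIN
  · simp [initS]
  · simp [initS]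
  · intro x hx hx2
    simp only [initS] at hx2
    push_cast at hx2
    linarith

/-- **Schoenfeld's inequality from a finished run**: if the invariant holds at a state whose prime
`P` exceeds `599`, then `|θ(x) − x| ≤ √x log² x/(8π)` for every real `599 ≤ x ≤ P`.
[cite: Schoenfeld1976, Thm. 10 (6.3)] -/
theorem abs_theta_sub_le_of_inv {s : TS} (hI : Inv s) (hP : 599 < s.p) {x : ℝ} (hx : 599 ≤ x)
    (hxP : x ≤ s.p) : |θ x - x| ≤ Real.sqrt x * Real.log x ^ 2 / (8 * Real.pi) := by
  rcases lt_or_eq_of_le hxP with hlt | heq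
  · exact hI.sch x hx hlt
  · rw [heq, abs_sub_le_iff]
    exact ⟨by have := hI.left hP.le; unfold bnd at this; linarith,
      by have := hI.right hP; unfold bnd at this; linarith⟩

end Literature.NumberTheory.LFunctions.ThetaChain

end
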